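import Mathlib
import HarnessLib.Audit
import Summits.PneNP.PneNP.Theorems.PstarForcing

/-!
# Two-chamber algebra at rank six: the EQ, EXC and NOR chamber regimes of the single gated cycle are empty (MODEL; E2 node N6; prover-1 g19)

FRONTIER range-avoidance ladder, rung F-N3 (`stmt-PneNP-19007`), cell `pnp-ideate` (`PstarGateNodesX.GateUnitCycleQuadX`; this seat's NOTES
`## N6X architecture`); restricted-model proof complexity — nothing here bears on `P` versus `NP`.

MODEL layer (a finite `𝔽₂`-module `M` = the gate chamber `coordKer {u}`).  When the fundamental form `P = u_e|H₁` of the gated chord has RANK AT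
LEAST SIX on the chamber, `PstarRankRigidity.eq_zero_or_eq_of_rank_six` (a quadratic vanishing on `Z(q)`, `q` of rank `≥ 6`, is `0` or `q`)
replaces the four-way `forcing_cases`/`classification` case tables, and the three chamber regimes of `PstarGateUnitCycleChamber.single_chamber_cases`
die:

* `not_rank_six_of_two_mul` — `μ₁ν₁ + μ₂ν₂ + κ` (affine factors) has rank `≤ 4`; hence `nor_not_rank_six` — the (NOR) regime
  (`P + c = (λ₁+1)m₁ + (λ₂+1)m₂`) contradicts rank six;
* `exc_product_const` — the (EXC) regime (`P = q₁ + ν₁ν₂ + κ` with `Z(q₁) ⊆ {P = c}`) forces `ν₁ν₂` CONSTANT (so it is the (EQ) regime):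
  `P ≡ c` on `{ν₁ν₂ = c + κ + 1}`, and `PstarRankRigidityFour.classification` of `P + c` against that rank-two quadric leaves only shapes of
  rank `≤ 4`;
* `eq_chambers_false` — the (EQ) regime.  Data: `q₁, q₀` (the second constraint on the two chambers `H₁ = {ℓ = 1}`, `H₀ = {ℓ = 0}`; they
  differ by an AFFINE function, being restrictions of one quadratic to parallel flats), `q'₁, q'₀` (the first constraint's state-free part, likewise),
  `Q₁ = u_e|H₁ = q₁ + κ` (EQ), (T3) in the form `(I) Z(q₁) ⊆ Z(q'₁)`, `(II) Z(q₀) ⊆ {q'₀ = 1}`, `Z(q₁) ⊆ {Q₁ = 1} ≠ ∅`, and (M0) at a tree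
  edge `j` avoiding `u` whose AND pair `(a, b)` has `B(a,b) = 1` (`B` = polar of `q₁`) and `[j ∈ T₁] = B'(a,b)` (`B'` = polar of `q'₁`): a
  witness in `H₀` with `q₀ = 1, q'₀ = [j ∈ T₁]` or in `H₁` with `q₁ = 1, q'₁ = [j ∈ T₁] + π`, `π = 1` if `u_e = 0`.  Rank six makes
  `q'₁ ∈ {0, q₁}` and `q'₀ ∈ {1, q₀ + 1}`; the mixed combinations make `q₁` or `q₀` affine (rank `0`), the pure ones have no (M0) witness.
-/

set_option linter.dupNamespace false -- `Summit.PneNP.PneNP.…`: summit = sub-problem name (D-0017 single-conjunct layout)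

open Finset Module
open Summit.PneNP.PneNP.Theorems.PstarCubeIdeals (IsAffineFn IsQuadFn isAffineFn_const)
open Summit.PneNP.PneNP.Theorems.PstarQuadRank (rad mem_rad polar_eq_zero_of_const finrank_rad_add_le)
open Summit.PneNP.PneNP.Theorems.PstarRankRigidityTwo (linPart symForm symForm_apply linPart_apply affine_mul_polar finrank_le_rad_symForm)
open Summit.PneNP.PneNP.Theorems.PstarRankRigidity (eq_zero_or_eq_of_rank_six)
open Summit.PneNP.PneNP.Theorems.PstarRankRigidityFour (classification)
open Summit.PneNP.PneNP.Theorems.PstarForcing (polar_unique exists_ne_of_rank_four not_rank_four_of_mul)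

namespace Summit.PneNP.PneNP.Theorems.PstarGateChamberAlgebra

/-- Every element of `𝔽₂` is `0` or `1`. -/
private theorem zmod2_cases (t : ZMod 2) : t = 0 ∨ t = 1 := by
  revert t; decide

/-- In `𝔽₂`, `x + x = 0`. -/
private theorem zmod2_add_self (x : ZMod 2) : x + x = 0 := by
  revert x; decide

variable {M : Type*} [AddCommGroup M] [Module (ZMod 2) M] [Fintype M] [DecidableEq M]

/-! ## Two products of affine functions have rank at most four -/

omit [DecidableEq M] in
/-- **`μ₁ν₁ + μ₂ν₂ + κ` has rank at most four.** -/
theorem not_rank_six_of_two_mul {Q : M → ZMod 2} {B : LinearMap.BilinForm (ZMod 2) M} (hB : ∀ x w, Q (x + w) = Q x + Q w + Q 0 + B x w)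
    {μ₁ ν₁ μ₂ ν₂ : M → ZMod 2} (h₁ : IsAffineFn μ₁) (h₁' : IsAffineFn ν₁) (h₂ : IsAffineFn μ₂) (h₂' : IsAffineFn ν₂) {κ : ZMod 2}
    (hQ : ∀ x, Q x = μ₁ x * ν₁ x + μ₂ x * ν₂ x + κ) :
    ¬ finrank (ZMod 2) (rad B) + 6 ≤ finrank (ZMod 2) M := by
  classical
  haveI : Module.Finite (ZMod 2) M := Module.Finite.of_finite
  set S₁ := symForm (linPart h₁) (linPart h₁') with hS₁
  set S₂ := symForm (linPart h₂) (linPart h₂') with hS₂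
  have hB' : ∀ x w, Q (x + w) = Q x + Q w + Q 0 + (S₁ + S₂) x w := by
    intro x w
    rw [hQ, hQ, hQ, hQ 0, LinearMap.add_apply, LinearMap.add_apply, affine_mul_polar h₁ h₁', affine_mul_polar h₂ h₂']
    generalize μ₁ x * ν₁ x = a; generalize μ₁ w * ν₁ w = a'; generalize μ₁ 0 * ν₁ 0 = a₀
    generalize μ₂ x * ν₂ x = b; generalize μ₂ w * ν₂ w = b'; generalize μ₂ 0 * ν₂ 0 = b₀
    generalize S₁ x w = s; generalize S₂ x w = s'
    generalize κ = k
    revert a a' a₀ b b' b₀ s s' k; decide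
  rw [polar_unique hB hB']
  have h1 : finrank (ZMod 2) M ≤ finrank (ZMod 2) (rad S₁) + 2 := finrank_le_rad_symForm (M := M) (linPart h₁) (linPart h₁')
  have h2 : finrank (ZMod 2) M ≤ finrank (ZMod 2) (rad S₂) + 2 := finrank_le_rad_symForm (M := M) (linPart h₂) (linPart h₂')
  have h3 : finrank (ZMod 2) (rad S₁) + finrank (ZMod 2) (rad S₂) ≤ finrank (ZMod 2) M + finrank (ZMod 2) (rad (S₁ + S₂)) :=
    finrank_rad_add_le (M := M) S₁ S₂
  omega

omit [DecidableEq M] in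
/-- **The (NOR) chamber regime contradicts rank six**: `Q + c = (λ₁+1)m₁ + (λ₂+1)m₂` has rank `≤ 4`. -/
theorem nor_not_rank_six {Q : M → ZMod 2} {B : LinearMap.BilinForm (ZMod 2) M} (hB : ∀ x w, Q (x + w) = Q x + Q w + Q 0 + B x w)
    {l₁ l₂ m₁ m₂ : M → ZMod 2} (hl₁ : IsAffineFn l₁) (hl₂ : IsAffineFn l₂) (hm₁ : IsAffineFn m₁) (hm₂ : IsAffineFn m₂) {c : ZMod 2}
    (hQ : ∀ x, Q x + c = (l₁ x + 1) * m₁ x + (l₂ x + 1) * m₂ x) :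
    ¬ finrank (ZMod 2) (rad B) + 6 ≤ finrank (ZMod 2) M := by
  have ha : ∀ {l : M → ZMod 2}, IsAffineFn l → IsAffineFn (fun x => l x + 1) := by
    intro l hl x w
    show l (x + w) + 1 = l x + 1 + (l w + 1) + (l 0 + 1)
    rw [hl x w]
    generalize l x = a; generalize l w = b; generalize l 0 = d
    revert a b d; decide
  refine not_rank_six_of_two_mul hB (ha hl₁) hm₁ (ha hl₂) hm₂ (κ := c) fun x => ?_
  have h := hQ x
  have e : ∀ q k r : ZMod 2, q + k = r → q = r + k := by decide
  exact e _ _ _ h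

/-! ## The (EXC) chamber regime -/

omit [DecidableEq M] in
/-- **The (EXC) regime at rank six is the (EQ) regime**: `P = q₁ + ν₁ν₂ + κ` with `Z(q₁) ⊆ {P = c}` and `P` of rank `≥ 6` forces `ν₁ν₂` constant. -/
theorem exc_product_const {P q₁ : M → ZMod 2} {B : LinearMap.BilinForm (ZMod 2) M} (hB : ∀ x w, P (x + w) = P x + P w + P 0 + B x w)
    (hrank : finrank (ZMod 2) (rad B) + 6 ≤ finrank (ZMod 2) M) {ν₁ ν₂ : M → ZMod 2} (hν₁ : IsAffineFn ν₁) (hν₂ : IsAffineFn ν₂)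
    {κ c : ZMod 2} (hE : ∀ w, P w = q₁ w + ν₁ w * ν₂ w + κ) (hZ : ∀ w, q₁ w = 0 → P w = c) :
    ∀ w, ν₁ w * ν₂ w = ν₁ 0 * ν₂ 0 := by
  classical
  have hrank4 : finrank (ZMod 2) (rad B) + 4 ≤ finrank (ZMod 2) M := by omega
  -- the rank-two quadric `ρ = ν₁ν₂ + c + κ + 1` and `g = P + c`, which vanishes on `Z(ρ)`
  set ρ : M → ZMod 2 := fun w => ν₁ w * ν₂ w + (c + κ + 1) with hρ
  set Bρ := symForm (linPart hν₁) (linPart hν₂) with hBρ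
  have hρB : ∀ x w, ρ (x + w) = ρ x + ρ w + ρ 0 + Bρ x w := by
    intro x w
    simp only [hρ]
    rw [affine_mul_polar hν₁ hν₂]
    generalize ν₁ x * ν₂ x = a; generalize ν₁ w * ν₂ w = a'; generalize ν₁ 0 * ν₂ 0 = a₀
    generalize Bρ x w = s; generalize c + κ + 1 = k
    revert a a' a₀ s k; decide
  have hg : IsQuadFn (fun w => P w + c) := by
    refine ⟨B, fun x w => ?_⟩
    show P (x + w) + c = P x + c + (P w + c) + (P 0 + c) + B x w
    rw [hB]
    generalize P x = a; generalize P w = a'; generalize P 0 = a₀; generalize B x w = s; generalize c = k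
    revert a a' a₀ s k; decide
  have hZ' : ∀ w, ρ w = 0 → P w + c = 0 := by
    intro w hw
    simp only [hρ] at hw
    -- on `Z(ρ)`: `ν₁ν₂ = c + κ + 1`; either `q₁ w = 0` (then `P w = c` by `hZ`) or `q₁ w = 1` (then `P w = 1 + (c + κ + 1) + κ = c`)
    show P w + c = 0
    have hprod : ν₁ w * ν₂ w = c + κ + 1 := by
      have e : ∀ a k : ZMod 2, a + k = 0 → a = k := by decide
      exact e _ _ hw
    by_cases hq : q₁ w = 0
    · rw [hZ w hq]; exact zmod2_add_self c
    · have hq1 : q₁ w = 1 := (zmod2_cases _).resolve_left hq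
      rw [hE w, hq1, hprod]
      have e : ∀ c k : ZMod 2, 1 + (c + k + 1) + k + c = 0 := by decide
      exact e c κ
  by_cases hρc : ∃ v, ρ v ≠ ρ 0
  · exfalso
    rcases classification hρB hρc hg hZ' with (h | h) | ⟨μ₁, μ₂, hμ₁, hμ₂, h | h⟩ | ⟨a, b, hab, hρf, m₁, m₂, hm₁, hm₂, h⟩
    · -- `P ≡ c`: constant, against rank
      obtain ⟨v, hv⟩ := exists_ne_of_rank_four hB hrank4
      have e : ∀ p k : ZMod 2, p + k = 0 → p = k := by decide
      exact hv ((e _ _ (h v)).trans (e _ _ (h 0)).symm)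
    · -- `P + c = ρ`: a product plus a constant
      refine not_rank_four_of_mul hB hν₁ hν₂ (κ := c + κ + 1 + c) (fun x => ?_) hrank4
      have hx := h x
      simp only [hρ] at hx
      have e : ∀ p k a d : ZMod 2, p + k = a + d → p = a + (d + k) := by decide
      exact e _ _ _ _ hx
    · -- `P + c = μ₁μ₂`
      refine not_rank_four_of_mul hB hμ₁ hμ₂ (κ := c) (fun x => ?_) hrank4
      have e : ∀ p k a : ZMod 2, p + k = a → p = a + k := by decide
      exact e _ _ _ (h x)
    · -- `ρ + (P + c) = μ₁μ₂`: two products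
      refine not_rank_six_of_two_mul hB hμ₁ hμ₂ hν₁ hν₂ (κ := c + κ + 1 + c) (fun x => ?_) hrank
      have hx := h x
      simp only [hρ] at hx
      have e : ∀ a d p k mm : ZMod 2, a + d + (p + k) = mm → p = mm + a + (d + k) := by decide
      exact e _ _ _ _ _ hx
    · -- (NOR): `P + c = (l₁+1)m₁ + (l₂+1)m₂`
      have haff : ∀ (y : M) (k : ZMod 2), IsAffineFn (fun x => Bρ x y + k) := by
        intro y k x w
        show Bρ (x + w) y + k = Bρ x y + k + (Bρ w y + k) + (Bρ 0 y + k)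
        rw [map_add, LinearMap.add_apply, map_zero, LinearMap.zero_apply, zero_add]
        generalize Bρ x y = s; generalize Bρ w y = t
        revert s t k; decide
      exact nor_not_rank_six hB (haff b (ρ b + ρ 0)) (haff a (ρ a + ρ 0)) hm₁ hm₂ (c := c) h hrank
  · push Not at hρc
    intro w
    have h := hρc w
    simp only [hρ] at h
    have e : ∀ a b k : ZMod 2, a + k = b + k → a = b := by decide
    exact e _ _ _ h

/-! ## The (EQ) chamber regime -/

omit [Fintype M] [DecidableEq M] in
/-- A quadratic shifted by an affine function keeps its polar form. -/
theorem quad_of_add_affine {q q₀ : M → ZMod 2} {B : LinearMap.BilinForm (ZMod 2) M} (hq : ∀ x w, q (x + w) = q x + q w + q 0 + B x w)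
    (hd : IsAffineFn (fun w => q₀ w + q w)) : ∀ x w, q₀ (x + w) = q₀ x + q₀ w + q₀ 0 + B x w := by
  intro x w
  have h1 := hd x w
  simp only at h1
  rw [hq x w] at h1
  generalize q₀ (x + w) = a at h1 ⊢
  generalize q₀ x = b at h1 ⊢; generalize q₀ w = b' at h1 ⊢; generalize q₀ 0 = b₀ at h1 ⊢
  generalize q x = d at h1 ⊢; generalize q w = d' at h1 ⊢; generalize q 0 = d₀ at h1 ⊢; generalize B x w = s at h1 ⊢
  revert a b b' b₀ d d' d₀ s; decide

omit [Fintype M] [DecidableEq M] in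
/-- An affine function has polar form zero. -/
theorem polar_zero_of_affine {q : M → ZMod 2} {B : LinearMap.BilinForm (ZMod 2) M} (hq : ∀ x w, q (x + w) = q x + q w + q 0 + B x w)
    (ha : IsAffineFn q) : ∀ x w, B x w = 0 := by
  intro x w
  have h1 := hq x w
  rw [ha x w] at h1
  generalize q x = b at h1; generalize q w = b' at h1; generalize q 0 = b₀ at h1; generalize B x w = s at h1
  revert b b' b₀ s; decide

omit [DecidableEq M] in
/-- **The (EQ) chamber regime is empty at rank six.**  See the module docstring. -/
theorem eq_chambers_false {q₁ q₀ q'₁ q'₀ Q₁ : M → ZMod 2} {B B' : LinearMap.BilinForm (ZMod 2) M}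
    (hq₁ : ∀ x w, q₁ (x + w) = q₁ x + q₁ w + q₁ 0 + B x w) (hrank : finrank (ZMod 2) (rad B) + 6 ≤ finrank (ZMod 2) M)
    (hq'₁ : ∀ x w, q'₁ (x + w) = q'₁ x + q'₁ w + q'₁ 0 + B' x w)
    (h₀ : IsAffineFn (fun w => q₀ w + q₁ w)) (h₀' : IsAffineFn (fun w => q'₀ w + q'₁ w))
    {κ : ZMod 2} (hEQ : ∀ w, Q₁ w = q₁ w + κ) (hZ : ∀ w, q₁ w = 0 → Q₁ w = 1) (hpt : ∃ w, q₁ w = 0)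
    (hI : ∀ w, q₁ w = 0 → q'₁ w = 0) (hII : ∀ w, q₀ w = 0 → q'₀ w = 1)
    {a b : M} (hab : B a b = 1)
    (hM0 : (∃ w, q₀ w = 1 ∧ q'₀ w = B' a b) ∨ (∃ w, ∃ π : ZMod 2, q₁ w = 1 ∧ q'₁ w = B' a b + π ∧ (Q₁ w = 0 → π = 1))) : False := by
  classical
  -- `κ = 1`: `Q₁ = q₁ + 1`
  have hκ : κ = 1 := by
    obtain ⟨w₀, hw₀⟩ := hpt
    have h := hZ w₀ hw₀
    rw [hEQ, hw₀, zero_add] at h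
    exact h
  -- polar forms on the other chamber
  have hq₀ := quad_of_add_affine hq₁ h₀
  have hq'₀ := quad_of_add_affine hq'₁ h₀'
  -- rank six: `q'₁ ∈ {0, q₁}` and `q'₀ + 1 ∈ {0, q₀}`
  have hA := eq_zero_or_eq_of_rank_six hq₁ hrank ⟨B', hq'₁⟩ hI
  have hg : IsQuadFn (fun w => q'₀ w + 1) := by
    refine ⟨B', fun x w => ?_⟩
    show q'₀ (x + w) + 1 = q'₀ x + 1 + (q'₀ w + 1) + (q'₀ 0 + 1) + B' x w
    rw [hq'₀]
    generalize q'₀ x = s; generalize q'₀ w = s'; generalize q'₀ 0 = s₀; generalize B' x w = t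
    revert s s' s₀ t; decide
  have hB0 := eq_zero_or_eq_of_rank_six hq₀ hrank hg (fun w hw => by show q'₀ w + 1 = 0; rw [hII w hw]; decide)
  -- tools
  have e10 : ∀ s : ZMod 2, s + 1 = 0 → s = 1 := by decide
  have e11 : ∀ s t : ZMod 2, s + 1 = t → s = t + 1 := by decide
  rcases hA with h0 | hq
  · -- `q'₁ ≡ 0`: `B' = 0`
    have hB'0 : B' a b = 0 := polar_zero_of_affine hq'₁ (fun x w => by rw [h0, h0, h0, h0]; decide) a b
    rcases hB0 with h1 | h1
    · -- `q'₀ ≡ 1`: no (M0) witness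
      rcases hM0 with ⟨w, -, hw⟩ | ⟨w, π, hw1, hw2, hw3⟩
      · rw [e10 _ (h1 w), hB'0] at hw; exact one_ne_zero hw
      · have hπ : π = 1 := hw3 (by rw [hEQ, hw1, hκ]; decide)
        rw [h0, hB'0, hπ, zero_add] at hw2; exact zero_ne_one hw2
    · -- `q'₀ = q₀ + 1` with `q'₀` affine: `q₀` affine, polar zero
      have haff : IsAffineFn q₀ := by
        intro x w
        have hd := h₀' x w
        simp only at hd
        rw [h0, h0, h0, h0, add_zero, add_zero, add_zero, add_zero, e11 _ _ (h1 (x + w)), e11 _ _ (h1 x), e11 _ _ (h1 w), e11 _ _ (h1 0)] at hd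
        generalize q₀ (x + w) = s at hd ⊢; generalize q₀ x = s₁ at hd ⊢; generalize q₀ w = s₂ at hd ⊢; generalize q₀ 0 = s₀ at hd ⊢
        revert s s₁ s₂ s₀; decide
      have := polar_zero_of_affine hq₀ haff a b
      rw [hab] at this; exact one_ne_zero this
  · -- `q'₁ = q₁`: `B' = B`
    have hBB : B' = B := polar_unique hq'₁ (fun x w => by rw [hq, hq, hq, hq, hq₁])
    rw [hBB, hab] at hM0
    rcases hB0 with h1 | h1
    · -- `q'₀ ≡ 1` with `q'₁ = q₁`: `q₁` affine, polar zero
      have haff : IsAffineFn q₁ := by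
        intro x w
        have hd := h₀' x w
        simp only at hd
        rw [hq, hq, hq, hq, e10 _ (h1 (x + w)), e10 _ (h1 x), e10 _ (h1 w), e10 _ (h1 0)] at hd
        generalize q₁ (x + w) = s at hd ⊢; generalize q₁ x = s₁ at hd ⊢; generalize q₁ w = s₂ at hd ⊢; generalize q₁ 0 = s₀ at hd ⊢
        revert s s₁ s₂ s₀; decide
      have := polar_zero_of_affine hq₁ haff a b
      rw [hab] at this; exact one_ne_zero this
    · -- `q'₀ = q₀ + 1`, `q'₁ = q₁`: no (M0) witness
      rcases hM0 with ⟨w, hw0, hw⟩ | ⟨w, π, hw1, hw2, hw3⟩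
      · have h := h1 w
        rw [hw, hw0] at h
        exact absurd h (by decide)
      · have hπ : π = 1 := hw3 (by rw [hEQ, hw1, hκ]; decide)
        rw [hq, hw1, hπ] at hw2
        exact absurd hw2 (by decide)

end Summit.PneNP.PneNP.Theorems.PstarGateChamberAlgebra
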